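import Summits.AtomisticToContinuum.HydrodynamicLimit.Theorems.JParityClosureEvenStressEnskogRung0Composition
import Summits.AtomisticToContinuum.HydrodynamicLimit.Theorems.JParityClosureEvenStressEnskogMeanEnskogRung0Helper
import Summits.AtomisticToContinuum.HydrodynamicLimit.Theorems.JParityClosureEvenStressEnskogFixedTimeVarianceReduction
import Summits.AtomisticToContinuum.HydrodynamicLimit.Theorems.JParityClosureEvenStressEnskogVelocityTruncationRung0
import Summits.AtomisticToContinuum.HydrodynamicLimit.Theorems.JParityClosureEvenStressEnskogCylinderPullbackRung0
import Summits.AtomisticToContinuum.HydrodynamicLimit.Theorems.JParityClosureEvenStressEnskogContinuityCorrectionRung0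
import Summits.AtomisticToContinuum.HydrodynamicLimit.Theorems.JParityClosureEvenStressEnskogShortFlightDeficitRung0
import Summits.AtomisticToContinuum.HydrodynamicLimit.Theorems.JParityClosureEvenStressEnskogThreeBodyCollisionSumRung0
import Summits.AtomisticToContinuum.HydrodynamicLimit.Theorems.JParityClosureEvenStressEnskogTubeMeanRung0OfContact
import Summits.AtomisticToContinuum.HydrodynamicLimit.Theorems.JParityClosureEvenStressEnskogEnskogRateVarianceRung0
import Summits.AtomisticToContinuum.HydrodynamicLimit.Theorems.JParityClosureEvenStressEnskogTubeVarianceRung0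
import HarnessLib

/-!
# `EvenStressEnskog` AT GLOBAL EQUILIBRIUM modulo the two canonical cluster-expansion inputs
# (crux line `even-rung-mean-variance`, `JParityClosure.EvenStressEnskog`, stmt-AtomisticToContinuum-13079)

The line's closure at rung 0 (constant profiles `a, u, θ`: the local Gibbs law is the flow-invariant canonical Gibbs law), assembled
from the landed stubs: the rung-0 composition `EvenStressEnskog_rung0_of`, S1|const `stub_velocityTruncationRung0` (velocity truncation
⇐ the Palm / window bound (H_K)₀ + Gaussian energy tails), S2|const `cylinderPullback_rung0_of_residuals` fed by the three rung-0 residual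
stubs (continuity correction, short-flight deficit, three-body shell count — all ⇐ the Palm bound + Ruelle-type two- and three-label statics),
S3|const `meanEnskogRung0_of_tubeMean_of_contactTheorem` fed by the tube-side mean H5 `stub_tubeMeanRung0OfContact` and the Literature
NAMED FACT `HardSphereContactTheorem`, and S4|const `fixedTimeVariance_rung0_of_static` fed by the static Enskog-rate variance
`stub_enskogRateVarianceRung0` (LLN) and the static tube variance `stub_tubeVarianceRung0_of_plateau2` MODULO the decorrelation
hypothesis Plateau' (relative asymptotic independence of two disjoint decorated dimers under the canonical configurational measure).
Remaining inputs, both canonical cluster-expansion statements at contact scale: `HardSphereContactTheorem` (Literature debt) and Plateau'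
(hypothesis) — see the lead's NOTES for the in-tree discharge route (two-pair decorated extension of `tendsto_twoPt`).
-/

noncomputable section

open MeasureTheory Set Filter Topology
open scoped ENNReal InnerProductSpace BigOperators Pointwise

namespace Summit.AtomisticToContinuum.HydrodynamicLimit.Theorems.EvenStressEnskog

open Literature.Analysis.FluidPDE Literature.MathematicalPhysics.KineticTheory
open Summit.AtomisticToContinuum.HydrodynamicLimit.Theses.JParityClosure

/-- From the flow form of the static Enskog-rate variance statement (registered `stub_enskogRateVarianceRung0`, variance of
`e_t ∘ Φ_t`) to the static form consumed by `fixedTimeVariance_rung0_of_static` (variance of `e_t`): the rung-0 law is flow invariant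
(`variance_comp_flow_localGibbsLaw_const`). -/
theorem enskogRateVariance_rung0_static_of_flow :
    (∃ η₀ : ℝ, 0 < η₀ ∧ ∀ (a θ : ℝ) (u : V3), 0 < a → 0 < θ → ∃ σ₀ : ℝ, 0 < σ₀ ∧ ∀ σ : ℝ, 0 < σ → σ < σ₀ → ∀ Φ : (N : ℕ) → HardSphereFlow (Torus.geometry (Fin 3)) (hsDiameter σ N) (N + 1), ∀ τ : ℝ, 0 < τ → ∀ χ : ℝ × UnitAddTorus (Fin 3) → ℝ, Continuous χ → ∀ g : ℝ → ℝ, Continuous g → (∀ a, η₀ ≤ a → g a = 0) → ∀ ς : ℝ, 0 < ς → ∃ r₀ : ℝ, 0 < r₀ ∧ ∀ r : ℝ, 0 < r → r < r₀ → ∀ L κ : ℝ, 1 ≤ L → 0 < κ → κ ≤ 1 → ∃ N₀ : ℕ, ∀ N : ℕ, N₀ ≤ N → ∀ k l : Fin 3, ∀ t ∈ Set.Icc (0 : ℝ) τ, (Measurable fun z => enskogRate σ N χ g (evenMarkTrunc k l L) r t z) ∧ ProbabilityTheory.variance (fun z => enskogRate σ N χ g (evenMarkTrunc k l L) r t ((Φ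 N).flow t z)) (localGibbsLaw σ (fun _ => a) (fun _ => u) (fun _ => θ) N (Φ N)) ≤ ς) →
    ∃ η₀ : ℝ, 0 < η₀ ∧ ∀ (a θ : ℝ) (u : V3), 0 < a → 0 < θ → ∃ σ₀ : ℝ, 0 < σ₀ ∧ ∀ σ : ℝ, 0 < σ → σ < σ₀ → ∀ Φ : (N : ℕ) → HardSphereFlow (Torus.geometry (Fin 3)) (hsDiameter σ N) (N + 1), ∀ τ : ℝ, 0 < τ → ∀ χ : ℝ × UnitAddTorus (Fin 3) → ℝ, Continuous χ → ∀ g : ℝ → ℝ, Continuous g → (∀ a', η₀ ≤ a' → g a' = 0) → ∀ ς : ℝ, 0 < ς → ∃ r₀ : ℝ, 0 < r₀ ∧ ∀ r : ℝ, 0 < r → r < r₀ → ∀ L κ : ℝ, 1 ≤ L → 0 < κ → κ ≤ 1 → ∃ N₀ : ℕ, ∀ N : ℕ, N₀ ≤ N → ∀ k l : Fin 3, ∀ t ∈ Set.Icc (0 : ℝ) τ, (Measurable fun z => enskogRate σ N χ g (evenMarkTrunc k l L) r t z) ∧ ProbabilityTheory.variance (fun z => enskogRate σ N χ g (evenMarkTrunc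 k l L) r t z) (localGibbsLaw σ (fun _ => a) (fun _ => u) (fun _ => θ) N (Φ N)) ≤ ς := by
  intro h
  obtain ⟨η₀, hη₀, H⟩ := h
  refine ⟨η₀, hη₀, fun a θ u ha hθ => ?_⟩
  obtain ⟨σ₀, hσ₀, H⟩ := H a θ u ha hθ
  refine ⟨σ₀, hσ₀, fun σ hσ hσlt Φ τ hτ χ hχ g hg hg0 ς hς => ?_⟩
  obtain ⟨r₀, hr₀, H⟩ := H σ hσ hσlt Φ τ hτ χ hχ g hg hg0 ς hς
  refine ⟨r₀, hr₀, fun r hr hrlt L κ hL hκ hκ1 => ?_⟩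
  obtain ⟨N₀, H⟩ := H r hr hrlt L κ hL hκ hκ1
  refine ⟨N₀, fun N hN k l t ht => ?_⟩
  obtain ⟨hm, hv⟩ := H N hN k l t ht
  refine ⟨hm, ?_⟩
  rwa [variance_comp_flow_localGibbsLaw_const σ a θ u N (Φ N) t hm.aemeasurable] at hv

/-- **`EvenStressEnskog` AT GLOBAL EQUILIBRIUM, MODULO THE CONTACT THEOREM AND THE DECORRELATION PLATEAU** (registered helper stub
`EvenStressEnskog_rung0_of_plateau_contact`): for constant profiles the crux follows from Plateau' and `HardSphereContactTheorem`. -/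
theorem EvenStressEnskog_rung0_of_plateau_contact :
    (∃ σ₁ : ℝ, 0 < σ₁ ∧ ∀ σ : ℝ, 0 < σ → σ < σ₁ → ∀ ζ : ℝ, 0 < ζ → ∃ N₀ : ℕ, ∀ N : ℕ, N₀ ≤ N → ∀ i j k l : Fin (N + 1), i ≠ j → i ≠ k → i ≠ l → j ≠ k → j ≠ l → k ≠ l → ∀ (h h' : T3 → ℝ), Measurable h → Measurable h' → (∀ y, |h y| ≤ 1) → (∀ y, |h' y| ≤ 1) → ∀ T T' : Set T3, MeasurableSet T → MeasurableSet T' → |(∫ x, h (x i) * T.indicator (fun _ => (1 : ℝ)) (x j - x i) * (h' (x k) * T'.indicator (fun _ => (1 : ℝ)) (x l - x k)) ∂posGibbsMeasure (fun _ : T3 => (1 : ℝ)) (hsDiameter σ N) (N + 1)) - (∫ x, h (x i) * T.indicator (fun _ => (1 : ℝ)) (x j - x i) ∂posGibbsMeasure (fun _ : T3 => (1 : ℝ)) (hsDiameter σ N) (N + 1)) * (∫ x, h' (x k) * T'.indicator (fun _ => (1 : ℝ)) (x l - x k) ∂posGibbsMeasure (fun _ : T3 => (1 : ℝ)) (hsDiameter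 σ N) (N + 1))| ≤ ζ * (MeasureTheory.volume T).toReal * (MeasureTheory.volume T').toReal) →
    Literature.MathematicalPhysics.StatisticalMechanics.HardSphereContactTheorem →
    ∃ η₀ : ℝ, 0 < η₀ ∧ ∀ (a θ : ℝ) (u : V3), 0 < a → 0 < θ → ∃ σ₀ : ℝ, 0 < σ₀ ∧ ∀ σ : ℝ, 0 < σ → σ < σ₀ → ∀ Φ : (N : ℕ) → HardSphereFlow (Torus.geometry (Fin 3)) (hsDiameter σ N) (N + 1), ∀ τ : ℝ, 0 < τ → ∀ χ : ℝ × UnitAddTorus (Fin 3) → ℝ, Continuous χ → ∀ g : ℝ → ℝ, Continuous g → (∀ a, η₀ ≤ a → g a = 0) → ∀ η δ : ℝ, 0 < η → 0 < δ → ∃ r₀ : ℝ, 0 < r₀ ∧ ∀ r : ℝ, 0 < r → r < r₀ → ∃ N₀ : ℕ, ∀ N : ℕ, N₀ ≤ N → ∀ k l : Fin 3, localGibbsLaw σ (fun _ => a) (fun _ => u) (fun _ => θ) N (Φ N) {z | η < |evenStat σ N (Φ N) τ χ g (evenMark k l) r z|} ≤ ENNReal.ofReal δ :=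
  fun hPl hCT =>
    EvenStressEnskog_rung0_of stub_velocityTruncationRung0
      (cylinderPullback_rung0_of_residuals stub_continuityCorrectionRung0 stub_shortFlightDeficitRung0
        stub_threeBodyCollisionSumRung0)
      (meanEnskogRung0_of_tubeMean_of_contactTheorem stub_tubeMeanRung0OfContact hCT)
      (fixedTimeVariance_rung0_of_static (stub_tubeVarianceRung0_of_plateau2 hPl)
        (enskogRateVariance_rung0_static_of_flow stub_enskogRateVarianceRung0))

end Summit.AtomisticToContinuum.HydrodynamicLimit.Theorems.EvenStressEnskog

end
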